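import Mathlib.CategoryTheory.Preadditive.Basic
import Mathlib.Tactic.Abel
import Literature.AlgebraicGeometry.Motives.PrymVariety
import Literature.AlgebraicGeometry.Motives.Jacobian
import HarnessLib

/-!
# The Hecke–Prym of an `F₂₁`-cover: endomorphism algebra (line `isotypic-unimodular-saturation`, stub `stub_heckePrymWeilPlane`)

Helper file (`--supports stmt-HodgeConjecture-1261`, crux `HeckePrymWeil.WeilTwelvefoldsSqrtMinus7`,
line `isotypic-unimodular-saturation`, stub `stub_heckePrymWeilPlane`).  Everything here is
UNCONDITIONAL endomorphism algebra, first in an arbitrary preadditive category and then on the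
tree's carriers `Motives.AbelianVariety ℂ`, `AbelianVariety.kerComponent`, `Jacobian.pushforward`.

The datum of the stub: `s`, `t` endomorphisms with `Φ₇(s) = 1 + s + ⋯ + s⁶ = 0` (on the Prym
`B = (ker Σ_{i<7} sⁱ)⁰`), `t³ = 𝟙`, and the `F₂₁`-relation `s t = t s²` (from `σ τ = τ σ²` on the
curve, Albanese functoriality); the Hecke element `η = s + s² + s⁴ - s³ - s⁵ - s⁶`; the Hecke–Prym
`P' = (ker(𝟙 - t))⁰` with its inclusion `j` (`j ≫ t = j`), the "norm" `N = 𝟙 + t + t²`, which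
factors as `N = q ≫ j` (`AbelianVariety.kerComponentLift`), and the restriction `φ'` of `η`
(`φ' ≫ j = j ≫ η`).  Proved:

* `comp_pow_seven_eq_id_of_cyclotomic₇` (`s⁷ = 𝟙`), `heckeElement_comp_self` (**the quadratic Gauss
  sum `η ≫ η = -7`**, certificate `η(x)² + 7 = (x⁵+2x⁴-x³+x-6)(x⁷-1) + Φ₇(x)`),
  `comp_heckeElement_comm` (`t η = η t`: conjugation by `t` permutes `{s,s²,s⁴}` and `{s³,s⁵,s⁶}`);
* `incl_comp_section` (`j ≫ q = 3`), `comp_section` (`t ≫ q = q`), the sandwich identity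
  `j ≫ t² Y t ≫ q = j ≫ Y ≫ q`, hence `ψ_{2k} = ψ_k` for `ψ_k := j ≫ sᵏ ≫ q` (`psi_two`, `psi_four`,
  `psi_six`, `psi_five`), and the two linear relations `6ψ₁ = 3φ' - 3`, `6ψ₃ = -3φ' - 3`
  (`six_smul_psi_one`, `six_smul_psi_three`) — the endomorphism half of "`j^*` is the
  `μ₃`-coinvariant map";
* `restrict_heckeElement_comp_self` (**`φ' ≫ φ' = -7`**, the second conjunct of the stub,
  abstractly), and on the carriers: `kerComponent_cyclotomic₇_restrict_eq_zero` (`Φ₇(s_B) = 0`),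
  `kerComponent_restrict_comp_pow_three` (`t_B³ = 𝟙`), `kerComponent_restrict_rel`
  (`s_B t_B = t_B s_B²`), `pushforward_rel` (`σ_* τ_* = τ_* σ_* σ_*`), `heckePrym_incl_comp`
  (`j ≫ t_B = j`), `heckePrym_exists_section` (`∃ q, q ≫ j = 𝟙 + t_B + t_B²`),
  `heckePrym_weilOperator_comp_self` (`φ' ≫ φ' = -((7 : ℤ) • 𝟙 P')` in the stub's binder shape).

No cohomology here (that is `…IsotypicHeckePrymPlaneCoinvariants` / `…Typing`); no definitions.
Pattern source: `Literature/AlgebraicGeometry/HodgeTheory/WeilClassesCyclicPrym` (§CyclotomicSix).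
-/

noncomputable section

set_option linter.dupNamespace false

open CategoryTheory
open Literature.AlgebraicGeometry Literature.AlgebraicGeometry.Motives

namespace Summit.HodgeConjecture.HodgeConjecture.Theorems.WeilTwelvefoldsSqrtMinus7.IsotypicUnimodularSaturation

/-! ### `Φ₇(s) = 0`: the order-`7` element and the Hecke element `η` -/

section CyclotomicSeven

variable {𝒞 : Type*} [Category 𝒞] [Preadditive 𝒞] {X : 𝒞} {s t : X ⟶ X}

/-- If `Φ₇(s) = 1 + s + ⋯ + s⁶ = 0` then `s⁷ = 𝟙` (`x⁷ - 1 = (x - 1)Φ₇(x)`). [folklore] -/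
theorem comp_pow_seven_eq_id_of_cyclotomic₇
    (h : 𝟙 X + s + s ≫ s + s ≫ s ≫ s + s ≫ s ≫ s ≫ s + s ≫ s ≫ s ≫ s ≫ s +
      s ≫ s ≫ s ≫ s ≫ s ≫ s = 0) :
    s ≫ s ≫ s ≫ s ≫ s ≫ s ≫ s = 𝟙 X := by
  have h' : s ≫ (𝟙 X + s + s ≫ s + s ≫ s ≫ s + s ≫ s ≫ s ≫ s + s ≫ s ≫ s ≫ s ≫ s +
      s ≫ s ≫ s ≫ s ≫ s ≫ s) = 0 := by rw [h, Limits.comp_zero]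
  simp only [Preadditive.comp_add, Category.comp_id] at h'
  rw [← sub_eq_zero]
  have e : s ≫ s ≫ s ≫ s ≫ s ≫ s ≫ s - 𝟙 X =
      (s + s ≫ s + s ≫ s ≫ s + s ≫ s ≫ s ≫ s + s ≫ s ≫ s ≫ s ≫ s + s ≫ s ≫ s ≫ s ≫ s ≫ s +
        s ≫ s ≫ s ≫ s ≫ s ≫ s ≫ s) -
      (𝟙 X + s + s ≫ s + s ≫ s ≫ s + s ≫ s ≫ s ≫ s + s ≫ s ≫ s ≫ s ≫ s +
        s ≫ s ≫ s ≫ s ≫ s ≫ s) := by abel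
  rw [e, h, h', sub_zero]

/-- **The quadratic Gauss sum: `η ≫ η = -7`** for the Hecke element
`η = s + s² + s⁴ - s³ - s⁵ - s⁶` when `Φ₇(s) = 0` (on every `ζ₇^a`-eigenline of `s`, `a ≠ 0`, `η`
is `(a/7)·(ζ+ζ²+ζ⁴-ζ³-ζ⁵-ζ⁶) = ± i√7`).  Certificate in `ℤ[x]`:
`η(x)² + 7 = (x⁵ + 2x⁴ - x³ + x - 6)(x⁷ - 1) + Φ₇(x)`, i.e. modulo `x⁷ = 1`,
`η(x)² = -6 + x + x² + ⋯ + x⁶ = -7 + Φ₇(x)`. [folklore] -/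
theorem heckeElement_comp_self
    (h : 𝟙 X + s + s ≫ s + s ≫ s ≫ s + s ≫ s ≫ s ≫ s + s ≫ s ≫ s ≫ s ≫ s +
      s ≫ s ≫ s ≫ s ≫ s ≫ s = 0) {η : X ⟶ X}
    (hη : η = s + s ≫ s + s ≫ s ≫ s ≫ s - s ≫ s ≫ s - s ≫ s ≫ s ≫ s ≫ s -
      s ≫ s ≫ s ≫ s ≫ s ≫ s) :
    η ≫ η = -((7 : ℤ) • 𝟙 X) := by
  have h7 := comp_pow_seven_eq_id_of_cyclotomic₇ h
  subst hη
  calc _ = -((7 : ℤ) • 𝟙 X) + (𝟙 X + s + s ≫ s + s ≫ s ≫ s + s ≫ s ≫ s ≫ s +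
        s ≫ s ≫ s ≫ s ≫ s + s ≫ s ≫ s ≫ s ≫ s ≫ s) := by
        simp only [Preadditive.add_comp, Preadditive.sub_comp, Preadditive.comp_add,
          Preadditive.comp_sub, Category.assoc, h7, Category.comp_id]
        abel
    _ = -((7 : ℤ) • 𝟙 X) := by rw [h, add_zero]

/-- **`t` commutes with the Hecke element** when `s t = t s²` and `Φ₇(s) = 0`: moving `t` to the
left doubles exponents, `sᵏ t = t s²ᵏ`, and `k ↦ 2k` permutes `{1,2,4}` and `{3,5,6}` modulo `7`.
[folklore] -/
theorem comp_heckeElement_comm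
    (h : 𝟙 X + s + s ≫ s + s ≫ s ≫ s + s ≫ s ≫ s ≫ s + s ≫ s ≫ s ≫ s ≫ s +
      s ≫ s ≫ s ≫ s ≫ s ≫ s = 0)
    (hst : s ≫ t = t ≫ s ≫ s) {η : X ⟶ X}
    (hη : η = s + s ≫ s + s ≫ s ≫ s ≫ s - s ≫ s ≫ s - s ≫ s ≫ s ≫ s ≫ s -
      s ≫ s ≫ s ≫ s ≫ s ≫ s) :
    t ≫ η = η ≫ t := by
  have h7 := comp_pow_seven_eq_id_of_cyclotomic₇ h
  subst hη
  simp only [Preadditive.add_comp, Preadditive.sub_comp, Preadditive.comp_add,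
    Preadditive.comp_sub, Category.assoc, hst, reassoc_of% hst, h7, Category.comp_id]
  abel

/-- `η` commutes with `𝟙 - t` (so it restricts to `(ker(𝟙 - t))⁰`, `kerComponentRestrict`).
[folklore] -/
theorem heckeElement_comp_one_sub
    (h : 𝟙 X + s + s ≫ s + s ≫ s ≫ s + s ≫ s ≫ s ≫ s + s ≫ s ≫ s ≫ s ≫ s +
      s ≫ s ≫ s ≫ s ≫ s ≫ s = 0)
    (hst : s ≫ t = t ≫ s ≫ s) {η : X ⟶ X}
    (hη : η = s + s ≫ s + s ≫ s ≫ s ≫ s - s ≫ s ≫ s - s ≫ s ≫ s ≫ s ≫ s -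
      s ≫ s ≫ s ≫ s ≫ s ≫ s) :
    η ≫ (𝟙 X - t) = (𝟙 X - t) ≫ η := by
  rw [Preadditive.comp_sub, Preadditive.sub_comp, Category.comp_id, Category.id_comp,
    comp_heckeElement_comm h hst hη]

/-- `N = 𝟙 + t + t²` is killed by `𝟙 - t` when `t³ = 𝟙`. [folklore] -/
theorem norm_comp_one_sub_eq_zero (h3 : t ≫ t ≫ t = 𝟙 X) :
    (𝟙 X + t + t ≫ t) ≫ (𝟙 X - t) = 0 := by
  simp only [Preadditive.add_comp, Preadditive.comp_sub, Category.comp_id, Category.id_comp,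
    Category.assoc, h3]
  abel

/-! ### The Hecke–Prym `j : P ↪ X` (`j ≫ t = j`) and the section `q` (`q ≫ j = 𝟙 + t + t²`) -/

variable {P : 𝒞} {j : P ⟶ X} {q : X ⟶ P}

/-- `j ≫ t = j` when `j` is killed by `𝟙 - t`. [folklore] -/
theorem incl_comp_eq_self (hj0 : j ≫ (𝟙 X - t) = 0) : j ≫ t = j := by
  rw [Preadditive.comp_sub, Category.comp_id, sub_eq_zero] at hj0
  exact hj0.symm

/-- **`j ≫ q = 3`**: `(j ≫ q) ≫ j = j ≫ N = j + j t + j t² = 3 j` and `j` is a monomorphism.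
[folklore] -/
theorem incl_comp_section [Mono j] (hj : j ≫ t = j) (hq : q ≫ j = 𝟙 X + t + t ≫ t) :
    j ≫ q = (3 : ℕ) • 𝟙 P := by
  rw [← cancel_mono j, Category.assoc, hq, Preadditive.comp_add, Preadditive.comp_add,
    Category.comp_id, reassoc_of% hj, hj, Preadditive.nsmul_comp, Category.id_comp]
  abel

/-- **`t ≫ q = q`**: `t ≫ q ≫ j = t N = N = q ≫ j`. [folklore] -/
theorem comp_section [Mono j] (h3 : t ≫ t ≫ t = 𝟙 X) (hq : q ≫ j = 𝟙 X + t + t ≫ t) :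
    t ≫ q = q := by
  rw [← cancel_mono j, Category.assoc, hq, Preadditive.comp_add, Preadditive.comp_add,
    Category.comp_id, h3]
  abel

/-- The sandwich identity `j ≫ (t² Y t) ≫ q = j ≫ Y ≫ q`. [folklore] -/
theorem incl_comp_conj_comp_section [Mono j] (hj : j ≫ t = j) (h3 : t ≫ t ≫ t = 𝟙 X)
    (hq : q ≫ j = 𝟙 X + t + t ≫ t) (Y : X ⟶ X) :
    j ≫ t ≫ t ≫ Y ≫ t ≫ q = j ≫ Y ≫ q := by
  rw [reassoc_of% hj, reassoc_of% hj, comp_section h3 hq]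

/-- `ψ₂ = ψ₁`: `j ≫ s² ≫ q = j ≫ s ≫ q` (`s² = t² s t`). [folklore] -/
theorem psi_two [Mono j] (hst : s ≫ t = t ≫ s ≫ s) (hj : j ≫ t = j) (h3 : t ≫ t ≫ t = 𝟙 X)
    (hq : q ≫ j = 𝟙 X + t + t ≫ t) :
    j ≫ s ≫ s ≫ q = j ≫ s ≫ q := by
  have e : t ≫ t ≫ s ≫ t ≫ q = s ≫ s ≫ q := by
    simp only [reassoc_of% hst, reassoc_of% h3]
  calc j ≫ s ≫ s ≫ q = j ≫ t ≫ t ≫ s ≫ t ≫ q := by rw [e]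
    _ = j ≫ s ≫ q := incl_comp_conj_comp_section hj h3 hq s

/-- `ψ₄ = ψ₁`: `j ≫ s⁴ ≫ q = j ≫ s ≫ q`. [folklore] -/
theorem psi_four [Mono j] (hst : s ≫ t = t ≫ s ≫ s) (hj : j ≫ t = j) (h3 : t ≫ t ≫ t = 𝟙 X)
    (hq : q ≫ j = 𝟙 X + t + t ≫ t) :
    j ≫ s ≫ s ≫ s ≫ s ≫ q = j ≫ s ≫ q := by
  have e : t ≫ t ≫ (s ≫ s) ≫ t ≫ q = s ≫ s ≫ s ≫ s ≫ q := by
    simp only [Category.assoc, reassoc_of% hst, reassoc_of% h3]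
  calc j ≫ s ≫ s ≫ s ≫ s ≫ q = j ≫ t ≫ t ≫ (s ≫ s) ≫ t ≫ q := by rw [e]
    _ = j ≫ s ≫ s ≫ q := by
      simpa only [Category.assoc] using incl_comp_conj_comp_section hj h3 hq (s ≫ s)
    _ = j ≫ s ≫ q := psi_two hst hj h3 hq

/-- `ψ₆ = ψ₃`: `j ≫ s⁶ ≫ q = j ≫ s³ ≫ q`. [folklore] -/
theorem psi_six [Mono j] (hst : s ≫ t = t ≫ s ≫ s) (hj : j ≫ t = j) (h3 : t ≫ t ≫ t = 𝟙 X)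
    (hq : q ≫ j = 𝟙 X + t + t ≫ t) :
    j ≫ s ≫ s ≫ s ≫ s ≫ s ≫ s ≫ q = j ≫ s ≫ s ≫ s ≫ q := by
  have e : t ≫ t ≫ (s ≫ s ≫ s) ≫ t ≫ q = s ≫ s ≫ s ≫ s ≫ s ≫ s ≫ q := by
    simp only [Category.assoc, reassoc_of% hst, reassoc_of% h3]
  calc j ≫ s ≫ s ≫ s ≫ s ≫ s ≫ s ≫ q = j ≫ t ≫ t ≫ (s ≫ s ≫ s) ≫ t ≫ q := by rw [e]
    _ = j ≫ s ≫ s ≫ s ≫ q := by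
      simpa only [Category.assoc] using incl_comp_conj_comp_section hj h3 hq (s ≫ s ≫ s)

/-- `ψ₅ = ψ₃`: `j ≫ s⁵ ≫ q = j ≫ s³ ≫ q` (`t² s⁶ t = s¹² = s⁵`, then `ψ₆ = ψ₃`). [folklore] -/
theorem psi_five [Mono j]
    (h : 𝟙 X + s + s ≫ s + s ≫ s ≫ s + s ≫ s ≫ s ≫ s + s ≫ s ≫ s ≫ s ≫ s +
      s ≫ s ≫ s ≫ s ≫ s ≫ s = 0)
    (hst : s ≫ t = t ≫ s ≫ s) (hj : j ≫ t = j) (h3 : t ≫ t ≫ t = 𝟙 X)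
    (hq : q ≫ j = 𝟙 X + t + t ≫ t) :
    j ≫ s ≫ s ≫ s ≫ s ≫ s ≫ q = j ≫ s ≫ s ≫ s ≫ q := by
  have h7 := comp_pow_seven_eq_id_of_cyclotomic₇ h
  have e : t ≫ t ≫ (s ≫ s ≫ s ≫ s ≫ s ≫ s) ≫ t ≫ q = s ≫ s ≫ s ≫ s ≫ s ≫ q := by
    simp only [Category.assoc, reassoc_of% hst, reassoc_of% h3, reassoc_of% h7]
  calc j ≫ s ≫ s ≫ s ≫ s ≫ s ≫ q = j ≫ t ≫ t ≫ (s ≫ s ≫ s ≫ s ≫ s ≫ s) ≫ t ≫ q := by rw [e]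
    _ = j ≫ s ≫ s ≫ s ≫ s ≫ s ≫ s ≫ q := by
      simpa only [Category.assoc] using
        incl_comp_conj_comp_section hj h3 hq (s ≫ s ≫ s ≫ s ≫ s ≫ s)
    _ = j ≫ s ≫ s ≫ s ≫ q := psi_six hst hj h3 hq

/-- **The two linear relations among `ψ₁ = j s q`, `ψ₃ = j s³ q`, `φ'`**: from
`j ≫ Φ₇(s) ≫ q = 0` (`3 + 3ψ₁ + 3ψ₃ = 0`) and `j ≫ η ≫ q = φ' ≫ j ≫ q = 3φ'`
(`3ψ₁ - 3ψ₃ = 3φ'`): `6ψ₁ = 3φ' - 3`. [folklore] -/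
theorem six_smul_psi_one [Mono j]
    (h : 𝟙 X + s + s ≫ s + s ≫ s ≫ s + s ≫ s ≫ s ≫ s + s ≫ s ≫ s ≫ s ≫ s +
      s ≫ s ≫ s ≫ s ≫ s ≫ s = 0)
    (hst : s ≫ t = t ≫ s ≫ s) (hj : j ≫ t = j) (h3 : t ≫ t ≫ t = 𝟙 X)
    (hq : q ≫ j = 𝟙 X + t + t ≫ t) {η : X ⟶ X}
    (hη : η = s + s ≫ s + s ≫ s ≫ s ≫ s - s ≫ s ≫ s - s ≫ s ≫ s ≫ s ≫ s -
      s ≫ s ≫ s ≫ s ≫ s ≫ s) {φ' : P ⟶ P} (hφ' : φ' ≫ j = j ≫ η) :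
    (6 : ℕ) • (j ≫ s ≫ q) = (3 : ℕ) • φ' - (3 : ℕ) • 𝟙 P := by
  have hZ : j ≫ (𝟙 X + s + s ≫ s + s ≫ s ≫ s + s ≫ s ≫ s ≫ s + s ≫ s ≫ s ≫ s ≫ s +
      s ≫ s ≫ s ≫ s ≫ s ≫ s) ≫ q = 0 := by rw [h, Limits.zero_comp, Limits.comp_zero]
  simp only [Preadditive.add_comp, Preadditive.comp_add, Category.id_comp, Category.assoc,
    incl_comp_section hj hq, psi_two hst hj h3 hq, psi_four hst hj h3 hq, psi_six hst hj h3 hq,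
    psi_five h hst hj h3 hq] at hZ
  have hE : j ≫ η ≫ q = (3 : ℕ) • φ' := by
    rw [← Category.assoc, ← hφ', Category.assoc, incl_comp_section hj hq, Preadditive.comp_nsmul,
      Category.comp_id]
  subst hη
  simp only [Preadditive.add_comp, Preadditive.sub_comp, Preadditive.comp_add,
    Preadditive.comp_sub, Category.assoc, psi_two hst hj h3 hq, psi_four hst hj h3 hq,
    psi_six hst hj h3 hq, psi_five h hst hj h3 hq] at hE
  calc (6 : ℕ) • (j ≫ s ≫ q)
      = (j ≫ s ≫ q + j ≫ s ≫ q + j ≫ s ≫ q - j ≫ s ≫ s ≫ s ≫ q - j ≫ s ≫ s ≫ s ≫ q -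
          j ≫ s ≫ s ≫ s ≫ q) +
        ((3 : ℕ) • 𝟙 P + j ≫ s ≫ q + j ≫ s ≫ q + j ≫ s ≫ s ≫ s ≫ q + j ≫ s ≫ q +
          j ≫ s ≫ s ≫ s ≫ q + j ≫ s ≫ s ≫ s ≫ q) - (3 : ℕ) • 𝟙 P := by abel
    _ = (3 : ℕ) • φ' + 0 - (3 : ℕ) • 𝟙 P := by rw [hE, hZ]
    _ = (3 : ℕ) • φ' - (3 : ℕ) • 𝟙 P := by rw [add_zero]

/-- … and `6ψ₃ = -3φ' - 3`. [folklore] -/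
theorem six_smul_psi_three [Mono j]
    (h : 𝟙 X + s + s ≫ s + s ≫ s ≫ s + s ≫ s ≫ s ≫ s + s ≫ s ≫ s ≫ s ≫ s +
      s ≫ s ≫ s ≫ s ≫ s ≫ s = 0)
    (hst : s ≫ t = t ≫ s ≫ s) (hj : j ≫ t = j) (h3 : t ≫ t ≫ t = 𝟙 X)
    (hq : q ≫ j = 𝟙 X + t + t ≫ t) {η : X ⟶ X}
    (hη : η = s + s ≫ s + s ≫ s ≫ s ≫ s - s ≫ s ≫ s - s ≫ s ≫ s ≫ s ≫ s -
      s ≫ s ≫ s ≫ s ≫ s ≫ s) {φ' : P ⟶ P} (hφ' : φ' ≫ j = j ≫ η) :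
    (6 : ℕ) • (j ≫ s ≫ s ≫ s ≫ q) = -((3 : ℕ) • φ') - (3 : ℕ) • 𝟙 P := by
  have hZ : j ≫ (𝟙 X + s + s ≫ s + s ≫ s ≫ s + s ≫ s ≫ s ≫ s + s ≫ s ≫ s ≫ s ≫ s +
      s ≫ s ≫ s ≫ s ≫ s ≫ s) ≫ q = 0 := by rw [h, Limits.zero_comp, Limits.comp_zero]
  simp only [Preadditive.add_comp, Preadditive.comp_add, Category.id_comp, Category.assoc,
    incl_comp_section hj hq, psi_two hst hj h3 hq, psi_four hst hj h3 hq, psi_six hst hj h3 hq,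
    psi_five h hst hj h3 hq] at hZ
  have hE : j ≫ η ≫ q = (3 : ℕ) • φ' := by
    rw [← Category.assoc, ← hφ', Category.assoc, incl_comp_section hj hq, Preadditive.comp_nsmul,
      Category.comp_id]
  subst hη
  simp only [Preadditive.add_comp, Preadditive.sub_comp, Preadditive.comp_add,
    Preadditive.comp_sub, Category.assoc, psi_two hst hj h3 hq, psi_four hst hj h3 hq,
    psi_six hst hj h3 hq, psi_five h hst hj h3 hq] at hE
  calc (6 : ℕ) • (j ≫ s ≫ s ≫ s ≫ q)
      = -(j ≫ s ≫ q + j ≫ s ≫ q + j ≫ s ≫ q - j ≫ s ≫ s ≫ s ≫ q - j ≫ s ≫ s ≫ s ≫ q -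
          j ≫ s ≫ s ≫ s ≫ q) +
        ((3 : ℕ) • 𝟙 P + j ≫ s ≫ q + j ≫ s ≫ q + j ≫ s ≫ s ≫ s ≫ q + j ≫ s ≫ q +
          j ≫ s ≫ s ≫ s ≫ q + j ≫ s ≫ s ≫ s ≫ q) - (3 : ℕ) • 𝟙 P := by abel
    _ = -((3 : ℕ) • φ') + 0 - (3 : ℕ) • 𝟙 P := by rw [hE, hZ]
    _ = -((3 : ℕ) • φ') - (3 : ℕ) • 𝟙 P := by rw [add_zero]

/-- **`φ' ≫ φ' = -7` on the Hecke–Prym** (abstractly): `φ' ≫ φ' ≫ j = j ≫ η ≫ η = -7 j` and `j`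
is a monomorphism. [folklore] -/
theorem restrict_heckeElement_comp_self [Mono j]
    (h : 𝟙 X + s + s ≫ s + s ≫ s ≫ s + s ≫ s ≫ s ≫ s + s ≫ s ≫ s ≫ s ≫ s +
      s ≫ s ≫ s ≫ s ≫ s ≫ s = 0) {η : X ⟶ X}
    (hη : η = s + s ≫ s + s ≫ s ≫ s ≫ s - s ≫ s ≫ s - s ≫ s ≫ s ≫ s ≫ s -
      s ≫ s ≫ s ≫ s ≫ s ≫ s) {φ' : P ⟶ P} (hφ' : φ' ≫ j = j ≫ η) :
    φ' ≫ φ' = -((7 : ℤ) • 𝟙 P) := by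
  rw [← cancel_mono j, Category.assoc, hφ', reassoc_of% hφ', heckeElement_comp_self h hη,
    Preadditive.comp_neg, Preadditive.neg_comp, Preadditive.comp_zsmul, Preadditive.zsmul_comp,
    Category.comp_id, Category.id_comp]

end CyclotomicSeven

/-! ### On the carriers: `B = (ker Σ sⁱ)⁰ ⊂ J`, `s_B`, `t_B`, `P' = (ker(𝟙 - t_B))⁰` -/

section Carriers

variable {J : AbelianVariety ℂ} {s t eN : J ⟶ J}
  {sB tB : AbelianVariety.kerComponent eN ⟶ AbelianVariety.kerComponent eN}

/-- **`Φ₇(s_B) = 0` on `B = (ker e_N)⁰`, `e_N = Σ_{i<7} sⁱ`**: `Φ₇(s_B) ≫ ι = ι ≫ e_N = 0`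
(`AbelianVariety.kerComponentι_comp`) and `ι` is a monomorphism.  Hence `s_B⁷ = 𝟙`
(`comp_pow_seven_eq_id_of_cyclotomic₇`) and `s_B` acts on every realisation of `B` through the
primitive `7`-th roots of unity: `B` is the Prym of the cyclic étale cover `C → C/⟨σ⟩`
(Patel–Zhang 2025 §5, `B = B_prim` for `n = 7` prime). [folklore] -/
theorem kerComponent_cyclotomic₇_restrict_eq_zero
    (heN : eN = 𝟙 J + s + s ≫ s + s ≫ s ≫ s + s ≫ s ≫ s ≫ s + s ≫ s ≫ s ≫ s ≫ s +
      s ≫ s ≫ s ≫ s ≫ s ≫ s)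
    (hsB : sB ≫ AbelianVariety.kerComponentι eN = AbelianVariety.kerComponentι eN ≫ s) :
    𝟙 _ + sB + sB ≫ sB + sB ≫ sB ≫ sB + sB ≫ sB ≫ sB ≫ sB + sB ≫ sB ≫ sB ≫ sB ≫ sB +
      sB ≫ sB ≫ sB ≫ sB ≫ sB ≫ sB = 0 := by
  subst heN
  have hι := AbelianVariety.kerComponentι_comp (𝟙 J + s + s ≫ s + s ≫ s ≫ s + s ≫ s ≫ s ≫ s +
    s ≫ s ≫ s ≫ s ≫ s + s ≫ s ≫ s ≫ s ≫ s ≫ s)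
  rw [← cancel_mono (AbelianVariety.kerComponentι _), Limits.zero_comp, ← hι]
  simp only [Preadditive.add_comp, Preadditive.comp_add, Category.id_comp, Category.comp_id,
    Category.assoc, hsB, reassoc_of% hsB]

/-- `t_B³ = 𝟙` on `B` when `t³ = 𝟙` on `J` (`ι` mono). [folklore] -/
theorem kerComponent_restrict_comp_pow_three
    (htB : tB ≫ AbelianVariety.kerComponentι eN = AbelianVariety.kerComponentι eN ≫ t)
    (ht3 : t ≫ t ≫ t = 𝟙 J) : tB ≫ tB ≫ tB = 𝟙 _ := by
  rw [← cancel_mono (AbelianVariety.kerComponentι eN), Category.assoc, Category.assoc, htB,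
    reassoc_of% htB, reassoc_of% htB, ht3, Category.comp_id, Category.id_comp]

/-- The `F₂₁`-relation restricts: `s_B t_B = t_B s_B²` on `B` when `s t = t s²` on `J`.
[folklore] -/
theorem kerComponent_restrict_rel
    (hsB : sB ≫ AbelianVariety.kerComponentι eN = AbelianVariety.kerComponentι eN ≫ s)
    (htB : tB ≫ AbelianVariety.kerComponentι eN = AbelianVariety.kerComponentι eN ≫ t)
    (hst : s ≫ t = t ≫ s ≫ s) : sB ≫ tB = tB ≫ sB ≫ sB := by
  rw [← cancel_mono (AbelianVariety.kerComponentι eN), Category.assoc, htB, reassoc_of% hsB, hst,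
    Category.assoc, Category.assoc, hsB, reassoc_of% hsB, reassoc_of% htB]

/-- **`σ_* τ_* = τ_* σ_* σ_*` on `J(C)` from `σ τ = τ σ²` on `C`** (Albanese functoriality of the
norm map, `Jacobian.pushforward_comp`; Lange 2023 §4.5.2). [folklore] -/
theorem pushforward_rel {C : SchemeOver ℂ} (𝒥 : Jacobian C) {σ τ : C ⟶ C}
    (hrel : σ ≫ τ = τ ≫ σ ≫ σ) {s' t' : 𝒥.J ⟶ 𝒥.J} (hs : s' = 𝒥.pushforward 𝒥 σ)
    (ht : t' = 𝒥.pushforward 𝒥 τ) : s' ≫ t' = t' ≫ s' ≫ s' := by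
  subst hs ht
  simp only [← Jacobian.pushforward_comp, hrel]

/-- `(τ_*)³ = 𝟙` from `τ³ = 𝟙` (Albanese functoriality; the tree's
`pushforward_comp_pow_three_of_pow_three` in `WeilClassesCyclicPrym`, restated to keep this file's
imports minimal). [folklore] -/
theorem pushforward_comp_pow_three {C : SchemeOver ℂ} (𝒥 : Jacobian C) {τ : C ⟶ C}
    (hτ : τ ≫ τ ≫ τ = 𝟙 C) {t' : 𝒥.J ⟶ 𝒥.J} (ht : t' = 𝒥.pushforward 𝒥 τ) :
    t' ≫ t' ≫ t' = 𝟙 𝒥.J := by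
  subst ht
  simp only [← Jacobian.pushforward_comp, hτ, Jacobian.pushforward_id]

variable {B : AbelianVariety ℂ} {tB' : B ⟶ B}

/-- The Hecke–Prym inclusion `j : P' = (ker(𝟙 - t_B))⁰ ↪ B` satisfies `j ≫ t_B = j`.
[folklore] -/
theorem heckePrym_incl_comp :
    AbelianVariety.kerComponentι (𝟙 B - tB') ≫ tB' = AbelianVariety.kerComponentι (𝟙 B - tB') :=
  incl_comp_eq_self (AbelianVariety.kerComponentι_comp (𝟙 B - tB'))

/-- **The section `q : B → P'` with `q ≫ j = 𝟙 + t_B + t_B²`** exists when `t_B³ = 𝟙`: the norm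
`N = 𝟙 + t_B + t_B²` is killed by `𝟙 - t_B`, so it factors through `(ker(𝟙 - t_B))⁰`
(`AbelianVariety.kerComponentLift`). [folklore] -/
theorem heckePrym_exists_section (h3 : tB' ≫ tB' ≫ tB' = 𝟙 B) :
    ∃ q : B ⟶ AbelianVariety.kerComponent (𝟙 B - tB'),
      q ≫ AbelianVariety.kerComponentι (𝟙 B - tB') = 𝟙 B + tB' + tB' ≫ tB' :=
  ⟨AbelianVariety.kerComponentLift (𝟙 B + tB' + tB' ≫ tB') (norm_comp_one_sub_eq_zero h3),
    AbelianVariety.kerComponentLift_ι _ _⟩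

end Carriers

/-- **Second conjunct of `stub_heckePrymWeilPlane`: `φ' ≫ φ' = -7` on the Hecke–Prym**, in the
stub's binder shape: `B = (ker e_N)⁰`, `e_N = Σ_{i<7} sⁱ`, `s_B` the restriction of `s`,
`P' = (ker(𝟙_B - t_B))⁰`, `φ'` restricting `η_B = s_B + s_B² + s_B⁴ - s_B³ - s_B⁵ - s_B⁶`.  Only
`Φ₇(s_B) = 0` is used (no hypothesis on `t_B`, on the curve, or on dimensions). [folklore] -/
theorem heckePrym_weilOperator_comp_self {J : AbelianVariety ℂ} {s eN : J ⟶ J}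
    (heN : eN = 𝟙 J + s + s ≫ s + s ≫ s ≫ s + s ≫ s ≫ s ≫ s + s ≫ s ≫ s ≫ s ≫ s +
      s ≫ s ≫ s ≫ s ≫ s ≫ s)
    {sB tB : AbelianVariety.kerComponent eN ⟶ AbelianVariety.kerComponent eN}
    (hsB : sB ≫ AbelianVariety.kerComponentι eN = AbelianVariety.kerComponentι eN ≫ s)
    (φ' : AbelianVariety.kerComponent (𝟙 (AbelianVariety.kerComponent eN) - tB) ⟶
        AbelianVariety.kerComponent (𝟙 (AbelianVariety.kerComponent eN) - tB))
    (hφ' : φ' ≫ AbelianVariety.kerComponentι (𝟙 (AbelianVariety.kerComponent eN) - tB) =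
        AbelianVariety.kerComponentι (𝟙 (AbelianVariety.kerComponent eN) - tB) ≫
          (sB + sB ≫ sB + sB ≫ sB ≫ sB ≫ sB - sB ≫ sB ≫ sB - sB ≫ sB ≫ sB ≫ sB ≫ sB -
            sB ≫ sB ≫ sB ≫ sB ≫ sB ≫ sB)) :
    φ' ≫ φ' = -((7 : ℤ) • 𝟙 (AbelianVariety.kerComponent
      (𝟙 (AbelianVariety.kerComponent eN) - tB))) :=
  restrict_heckeElement_comp_self (kerComponent_cyclotomic₇_restrict_eq_zero heN hsB) rfl hφ'

end Summit.HodgeConjecture.HodgeConjecture.Theorems.WeilTwelvefoldsSqrtMinus7.IsotypicUnimodularSaturation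

end
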